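import Literature.AnabelianGeometry.SemiGraphs.CoveringGraphEquiv
import Literature.AnabelianGeometry.SemiGraphs.SemiGraphIsoTransport
import Literature.AnabelianGeometry.SemiGraphs.ProperBranchLifting
import Literature.AnabelianGeometry.SemiGraphs.Pullback
import HarnessLib

/-!
# [SemiAnbd] Def. 3.5 (i): lifting a morphism of semi-graphs to the covering semi-graph of an object
# of `B^cov(G)` through a system of points (bridge brick L1c-base, definition layer)

Mochizuki, *Semi-graphs of anabelioids*, Publ. RIMS **42** (2006), Def. 3.5 (i) p. 37 (the covering
`G_S → G` "associated, in a natural way, to any object `S` of `B^cov(G)`", whose vertices / edges over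
`v` / `e` are the `Π_v`- / `Π_e`-orbits of `S_v` / `S_e`, abc-iut-L3-t2's `CovObj.coveringSemiGraph`),
Def. 2.2 (i) p. 23 ("the vertices … of `𝔾'` that lie over a vertex `v` … correspond to the connected
components of `S_v`") (kurims `paper:url-f33ace170ff4`). [cite: MochizukiSemiAnbd2006, Def 3.5(i) p.37]

Brick of the (R1) bridge law L1 «finite étale ⇒ tempered» (HOME/staging/L3/L3-t3/R1-BRIDGE-SHAPES.md
§4, interface owner abc-iut-L3-t3), at abc-iut-L3-t2's level (profinite presentations, no anabelioids):
for `S ∈ B^cov(P)` and a morphism of semi-graphs `f : G → 𝔾_P` together with a SYSTEM OF POINTS —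
a point `y_w ∈ S_{f w}` for every vertex `w` of `G` and `z_{e'} ∈ S_{f e'}` for every edge, such that
along every branch `b'` of `e'` abutting to `w` the gluing of `S` carries `z_{e'}` into the orbit of
`y_w` —

* `CovObj.pointLift S f y z hglue : G ⟶ S.coveringSemiGraph` — THE LIFT `w ↦ (f w, [y_w])`,
  `e' ↦ (f e', [z_{e'}])`, `b' ↦ (f b', [z_{e(b')}])` of `f` through the covering semi-graph
  (`pointLift_comp_base : pointLift ≫ (G_S → G) = f`);
* `CovObj.pointLift_branchMap_bijective` — it is bijective on branches as soon as it is bijective on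
  edges (an edge has exactly two branches on both sides);
* `CovObj.pointLift_abuts_eq_none` — over a PROPER `f` (verticial cardinalities preserved, p. 23 "lies
  over some proper morphism of semi-graphs") branches abutting to no vertex go to such branches;
* `CovObj.pointLiftIso` — hence, when bijective on vertices and on edges over a proper `f`, an
  ISOMORPHISM of semi-graphs `G ≅ 𝔾_{S}` over `𝔾_P` (`SemiGraph.Hom.isoOfBijective`).

The anabelioid-level input (for the finite étale covering attached to `A ∈ B(ℋ)`: components ↔
orbits give the bijections, the last clause of `Hom.IsFiniteEtaleCoveringOf` gives `hglue`) is the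
companion `SgAFiniteEtaleCoveringGraphIso.lean`.  Definitions + bookkeeping only; nothing of the paper
is asserted; no side taken on [IUTchIII] Cor. 3.12.
-/

noncomputable section

namespace Literature.AnabelianGeometry.SemiGraphs

open CategoryTheory

universe u

/-! ### Proper morphisms send branches abutting to no vertex to branches abutting to no vertex -/

namespace SemiGraph

variable {G G' : SemiGraph.{u}} (φ : G ⟶ G')

/-- Over a PROPER morphism of semi-graphs a branch abutting to no vertex goes to a branch abutting to
no vertex (the verticial portions of `e` and `φ e` are in bijection, `branchMap_verticialPortion_bijective`).
[cite: MochizukiSemiAnbd2006, §1 p.14] -/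
theorem IsProper.abuts_branchMap_eq_none (hφ : IsProper φ) (b : G.Branch) (hb : G.abuts b = none) :
    G'.abuts (φ.branchMap b) = none := by
  by_contra hne
  obtain ⟨v', hv'⟩ := Option.ne_none_iff_exists'.mp hne
  obtain ⟨b₁, v₁, hb₁e, hb₁, hv₁, -⟩ :=
    exists_branch_preimage_abuts φ hφ (G.edgeOf b) (φ.branchMap b) (φ.edgeOf_branchMap b) v' hv'
  have hbb : b₁ = b := φ.branchMap_injOn b₁ b hb₁e hb₁
  rw [hbb, hb] at hv₁
  exact absurd hv₁ (by simp)

end SemiGraph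

namespace ProfiniteSemiGraph

namespace CovObj

variable {P : ProfiniteSemiGraph.{u}} (S : CovObj P)

/-! ### Transport of points of edge fibres along equalities of edges -/

/-- Transport of points of the edge fibres of `S` along an equality of edges (bookkeeping for
`edgeOf (f b') = f (edgeOf b')`). [cite: MochizukiSemiAnbd2006, Def 3.5(i) p.37] -/
def castPtE {e₁ e₂ : P.graph.Edge} (h : e₁ = e₂) (t : (S.SE e₁).obj.V) : (S.SE e₂).obj.V :=
  cast (congrArg (fun e => ((S.SE e).obj.V : Type u)) h) t

/-- Transport along `rfl` is the identity. [cite: MochizukiSemiAnbd2006, Def 3.5(i) p.37] -/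
@[simp] theorem castPtE_rfl (e : P.graph.Edge) (t : (S.SE e).obj.V) : S.castPtE rfl t = t := rfl

/-- The orbit of a transported point is the transported orbit. [cite: MochizukiSemiAnbd2006, Def 3.5(i) p.37] -/
theorem cl_castPtE_heq {e₁ e₂ : P.graph.Edge} (h : e₁ = e₂) (t : (S.SE e₁).obj.V) :
    HEq (BTemp.cl (S.SE e₂) (S.castPtE h t)) (BTemp.cl (S.SE e₁) t) := by
  subst h; rfl

/-- Two points have the same orbit iff their transports do. [cite: MochizukiSemiAnbd2006, Def 3.5(i) p.37] -/
theorem cl_castPtE_eq_iff {e₁ e₂ : P.graph.Edge} (h : e₁ = e₂) (t t' : (S.SE e₁).obj.V) :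
    BTemp.cl (S.SE e₂) (S.castPtE h t) = BTemp.cl (S.SE e₂) (S.castPtE h t') ↔
      BTemp.cl (S.SE e₁) t = BTemp.cl (S.SE e₁) t' := by
  subst h; exact Iff.rfl

/-- As points of `Σ e, Orbits (S_e)`, a transported point has the class of the original.
[cite: MochizukiSemiAnbd2006, Def 3.5(i) p.37] -/
theorem sigma_mk_cl_castPtE {e₁ e₂ : P.graph.Edge} (h : e₁ = e₂) (t : (S.SE e₁).obj.V) :
    (⟨e₂, BTemp.cl (S.SE e₂) (S.castPtE h t)⟩ : S.coveringSemiGraph.Edge) = ⟨e₁, BTemp.cl (S.SE e₁) t⟩ := by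
  subst h; rfl

/-! ### Systems of points and the lift -/

variable {G : SemiGraph.{u}} (f : G ⟶ P.graph)
  (y : ∀ w : G.Vertex, (S.SV (f.vertexMap w)).obj.V)
  (z : ∀ e' : G.Edge, (S.SE (f.edgeMap e')).obj.V)

/-- The GLUING CONDITION on a system of points `(y_w)_w`, `(z_{e'})_{e'}` of `S` over `f`: along every
branch `b'` of `G` abutting to `w`, the gluing `S_{f e'} ≅ (f b')^* S_{f w}` of `S` carries `z_{e'}`
(`e' = e(b')`) into the `Π_{f w}`-orbit of `y_w` — the incidence of the covering semi-graph
(`CovObj.glueOrbit`) matches that of `G`. [cite: MochizukiSemiAnbd2006, Def 3.5(i) p.37] -/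
@[mk_iff] structure GlueCondition : Prop where
  /-- along a branch `b'` abutting to `w`, the gluing carries `z_{e(b')}` into the orbit of `y_w` -/
  cl_glue_eq : ∀ (b' : G.Branch) (w : G.Vertex) (h' : G.abuts b' = some w),
    BTemp.cl (S.SV (f.vertexMap w))
        ((S.glue (f.branchMap b') (f.vertexMap w) (f.abuts_branchMap b' w h')).hom.hom.hom
          (S.castPtE (f.edgeOf_branchMap b').symm (z (G.edgeOf b')))) =
      BTemp.cl (S.SV (f.vertexMap w)) (y w)

variable {S f y z}

/-- The gluing condition in terms of `glueOrbit`. [cite: MochizukiSemiAnbd2006, Def 3.5(i) p.37] -/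
theorem GlueCondition.glueOrbit_eq (hglue : S.GlueCondition f y z) (b' : G.Branch) (w : G.Vertex)
    (h' : G.abuts b' = some w) :
    S.glueOrbit (f.branchMap b') (f.vertexMap w) (f.abuts_branchMap b' w h')
        (BTemp.cl _ (S.castPtE (f.edgeOf_branchMap b').symm (z (G.edgeOf b')))) =
      BTemp.cl (S.SV (f.vertexMap w)) (y w) :=
  hglue.cl_glue_eq b' w h'

variable (S f y z)

/-- **The lift of `f : G → 𝔾_P` through the covering semi-graph `𝔾_S` of `S ∈ B^cov(P)` determined by
a system of points satisfying the gluing condition**: `w ↦ (f w, [y_w])`, `e' ↦ (f e', [z_{e'}])`,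
`b' ↦ (f b', [z_{e(b')}])` (Def. 3.5 (i): the vertices / edges of the covering over `v` / `e` are the
orbits of `S_v` / `S_e`). [cite: MochizukiSemiAnbd2006, Def 3.5(i) p.37] -/
def pointLift (hglue : S.GlueCondition f y z) : G ⟶ S.coveringSemiGraph where
  vertexMap w := ⟨f.vertexMap w, BTemp.cl (S.SV (f.vertexMap w)) (y w)⟩
  edgeMap e' := ⟨f.edgeMap e', BTemp.cl (S.SE (f.edgeMap e')) (z e')⟩
  branchMap b' := ⟨f.branchMap b',
    BTemp.cl (S.SE (P.graph.edgeOf (f.branchMap b')))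
      (S.castPtE (f.edgeOf_branchMap b').symm (z (G.edgeOf b')))⟩
  edgeOf_branchMap b' := S.sigma_mk_cl_castPtE (f.edgeOf_branchMap b').symm (z (G.edgeOf b'))
  branchMap_injOn b₁ b₂ he hb := f.branchMap_injOn b₁ b₂ he (congrArg Sigma.fst hb)
  abuts_branchMap b' w h' := by
    rw [S.coveringAbuts_eq (f.abuts_branchMap b' w h'), hglue.glueOrbit_eq b' w h']

variable (hglue : S.GlueCondition f y z)

/-- The lift on vertices. [cite: MochizukiSemiAnbd2006, Def 3.5(i) p.37] -/
@[simp] theorem pointLift_vertexMap (w : G.Vertex) :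
    (S.pointLift f y z hglue).vertexMap w = ⟨f.vertexMap w, BTemp.cl (S.SV (f.vertexMap w)) (y w)⟩ := rfl

/-- The lift on edges. [cite: MochizukiSemiAnbd2006, Def 3.5(i) p.37] -/
@[simp] theorem pointLift_edgeMap (e' : G.Edge) :
    (S.pointLift f y z hglue).edgeMap e' = ⟨f.edgeMap e', BTemp.cl (S.SE (f.edgeMap e')) (z e')⟩ := rfl

/-- The lift on branches. [cite: MochizukiSemiAnbd2006, Def 3.5(i) p.37] -/
@[simp] theorem pointLift_branchMap (b' : G.Branch) :
    (S.pointLift f y z hglue).branchMap b' = ⟨f.branchMap b',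
      BTemp.cl (S.SE (P.graph.edgeOf (f.branchMap b')))
        (S.castPtE (f.edgeOf_branchMap b').symm (z (G.edgeOf b')))⟩ := rfl

/-- **The lift lies over `f`**: composed with the structure morphism `𝔾_S → 𝔾_P` of the covering
semi-graph it is `f`. [cite: MochizukiSemiAnbd2006, Def 3.5(i) p.37] -/
theorem pointLift_comp_base :
    S.pointLift f y z hglue ≫ (show S.coveringGraph.graph ⟶ P.graph from S.coveringHom.base) = f :=
  SemiGraph.hom_ext _ _ rfl rfl rfl

/-! ### Bijectivity -/

/-- **Bijective on branches as soon as bijective on edges**: an edge has exactly two branches, on `G`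
and on the covering semi-graph alike, and the lift restricted to the branches of an edge is the
bijection `e' ⥲ f e'` of `f` (§1 p. 11). [cite: MochizukiSemiAnbd2006, §1 p.11] -/
theorem pointLift_branchMap_bijective
    (he : Function.Bijective (S.pointLift f y z hglue).edgeMap) :
    Function.Bijective (S.pointLift f y z hglue).branchMap := by
  constructor
  · intro b₁ b₂ hb
    have hb1 : f.branchMap b₁ = f.branchMap b₂ := congrArg Sigma.fst hb
    have hedge : (S.pointLift f y z hglue).edgeMap (G.edgeOf b₁) =
        (S.pointLift f y z hglue).edgeMap (G.edgeOf b₂) := by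
      rw [← (S.pointLift f y z hglue).edgeOf_branchMap b₁,
        ← (S.pointLift f y z hglue).edgeOf_branchMap b₂, hb]
    exact f.branchMap_injOn b₁ b₂ (he.1 hedge) hb1
  · rintro ⟨c, ω⟩
    obtain ⟨e', he'⟩ := he.2 ⟨P.graph.edgeOf c, ω⟩
    have hfe : f.edgeMap e' = P.graph.edgeOf c := congrArg Sigma.fst he'
    obtain ⟨b', hb'e, hb'⟩ := SemiGraph.Hom.exists_branchMap_eq f e' c hfe.symm
    refine ⟨b', ?_⟩
    subst hb'e
    subst hb'
    refine Sigma.ext rfl ?_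
    have h1 : HEq (BTemp.cl (S.SE (P.graph.edgeOf (f.branchMap b')))
        (S.castPtE (f.edgeOf_branchMap b').symm (z (G.edgeOf b'))))
        (BTemp.cl (S.SE (f.edgeMap (G.edgeOf b'))) (z (G.edgeOf b'))) :=
      S.cl_castPtE_heq _ _
    have h2 : HEq (BTemp.cl (S.SE (f.edgeMap (G.edgeOf b'))) (z (G.edgeOf b'))) ω :=
      (Sigma.mk.inj_iff.mp he').2
    exact h1.trans h2

/-- **Over a proper `f`, the lift sends branches abutting to no vertex to branches abutting to no
vertex.** [cite: MochizukiSemiAnbd2006, Def. 2.2(i) p.23] -/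
theorem pointLift_abuts_eq_none (hf : SemiGraph.IsProper f) (b' : G.Branch) (hb' : G.abuts b' = none) :
    S.coveringSemiGraph.abuts ((S.pointLift f y z hglue).branchMap b') = none := by
  have hP : P.graph.abuts (f.branchMap b') = none := hf.abuts_branchMap_eq_none f b' hb'
  rw [pointLift_branchMap]
  have key : ∀ (o : Option P.graph.Vertex) (ho : P.graph.abuts (f.branchMap b') = o)
      (ω : BTemp.Orbits (S.SE (P.graph.edgeOf (f.branchMap b')))), o = none →
        S.coveringAbutsAux (f.branchMap b') o ho ω = none := by
    rintro (_ | w) ho ω hnone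
    · rfl
    · exact absurd hnone (Option.some_ne_none w)
  exact key _ rfl _ hP

/-- **The lift is an isomorphism of semi-graphs `G ≅ 𝔾_S`** when it is bijective on vertices and on
edges and `f` is proper (then it is bijective on branches and respects branches abutting to no
vertex; `SemiGraph.Hom.isoOfBijective`). [cite: MochizukiSemiAnbd2006, Def. 2.2(i) p.23] -/
def pointLiftIso (hf : SemiGraph.IsProper f)
    (hv : Function.Bijective (S.pointLift f y z hglue).vertexMap)
    (he : Function.Bijective (S.pointLift f y z hglue).edgeMap) : G ≅ S.coveringSemiGraph :=
  SemiGraph.Hom.isoOfBijective (S.pointLift f y z hglue) hv he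
    (S.pointLift_branchMap_bijective f y z hglue he) (S.pointLift_abuts_eq_none f y z hglue hf)

/-- The isomorphism is the lift. [cite: MochizukiSemiAnbd2006, Def. 2.2(i) p.23] -/
@[simp] theorem pointLiftIso_hom (hf : SemiGraph.IsProper f)
    (hv : Function.Bijective (S.pointLift f y z hglue).vertexMap)
    (he : Function.Bijective (S.pointLift f y z hglue).edgeMap) :
    (S.pointLiftIso f y z hglue hf hv he).hom = S.pointLift f y z hglue := rfl

/-- … in particular the lift is then an isomorphism in the category of semi-graphs.
[cite: MochizukiSemiAnbd2006, Def. 2.2(i) p.23] -/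
theorem isIso_pointLift (hf : SemiGraph.IsProper f)
    (hv : Function.Bijective (S.pointLift f y z hglue).vertexMap)
    (he : Function.Bijective (S.pointLift f y z hglue).edgeMap) :
    IsIso (C := SemiGraph.{u}) (S.pointLift f y z hglue) :=
  (S.pointLiftIso f y z hglue hf hv he).isIso_hom

/-- Bijectivity on vertices is bijectivity of `w ↦ (f w, [y_w])` into `Σ v, Orbits (S_v)` (the type of
vertices of the covering semi-graph), restated for consumers. [cite: MochizukiSemiAnbd2006, Def 3.5(i) p.37] -/
theorem pointLift_vertexMap_bijective_iff :
    Function.Bijective (S.pointLift f y z hglue).vertexMap ↔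
      Function.Bijective (fun w : G.Vertex =>
        (⟨f.vertexMap w, BTemp.cl (S.SV (f.vertexMap w)) (y w)⟩ : Σ v, BTemp.Orbits (S.SV v))) :=
  Iff.rfl

/-- Bijectivity on edges is bijectivity of `e' ↦ (f e', [z_{e'}])`. [cite: MochizukiSemiAnbd2006, Def 3.5(i) p.37] -/
theorem pointLift_edgeMap_bijective_iff :
    Function.Bijective (S.pointLift f y z hglue).edgeMap ↔
      Function.Bijective (fun e' : G.Edge =>
        (⟨f.edgeMap e', BTemp.cl (S.SE (f.edgeMap e')) (z e')⟩ : Σ e, BTemp.Orbits (S.SE e))) :=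
  Iff.rfl

end CovObj

end ProfiniteSemiGraph

end Literature.AnabelianGeometry.SemiGraphs

end
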